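import Mathlib
import Summits.Ventures.PercRepro2.CaseOneReduced
import Summits.Ventures.PercRepro2.CaseOneCubicI

/-!
# The `(i)`-side transport and `(J1₁)` from the fully reduced typed graphs (blind cell PercRepro2,
p2 g0, 2026-08-25; sub-claim S1 for sub-claim S5; the mirror of `CaseOneReduced.lean`)

p1's `CaseOneCubicI.lean` writes the cleared `(i)` as the cubic form of the four-term kernel `KI`
and states the typed `(i)` as `TypedI`. Here, exactly as for `KII`:

* **`KI_eq_KIst`** / **`KI_eq_stKer`** — `KI` through the 7-coordinate state (`KIst`);
* **`ruleKernel_KIst`** — the inputs of the reduction calculus for `KIst` (every factor within `Q`;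
  the four `b`-factors in the first copy; the `o`-factor in the first copy for term 3, in the
  second for terms 1, 2, 4);
* **`typedI_of_reduced`**, **`zSplitI_of_reduced`** — `(i)` for every admissible weight vector from
  `(i)` on the fully reduced typed graphs at the all-closed pinning;
* **`jOneOne_of_reduced`** — `(J1₁)` for every admissible weight vector from `(i)` and `(ii)` on the
  fully reduced typed graphs (with `CaseOneReduced.typedII_of_reduced` and p1's `jOneOne_of_pinned`).

Own code; standard axioms.
-/

namespace Summit.Ventures.PercRepro2

open UnionCluster

namespace CaseOne

open CovForm CovForm.OneTyped CovForm.TypedRed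

/-! ## The `(i)`-side kernel on states -/

section StateKernelI

/-- `1_QB₁ = 1[b ∈ C₁] 1_Q` on states. -/
def qb1S (s : St) : ℤ := if s.Lb && !s.q' then 1 else 0
/-- `1_AB₁ = 1[b ∈ C₁] 1[a₃ ∈ C₁] 1_Q` on states. -/
def ab1S (s : St) : ℤ := if s.Lb && s.L3 && !s.q' then 1 else 0
/-- `1_AB₁O = 1[b ∈ C₁] 1[a₃ ∈ C₁] 1[o ∈ C₂] 1_Q` on states. -/
def ab1oS (s : St) : ℤ := if s.Lb && s.L3 && s.Ho && !s.q' then 1 else 0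

/-- **The `(i)`-side kernel on states**: the four terms of the cleared `(i)`. -/
def KIst (x y z : St) : ℤ :=
  qb1S x * (aoS y * pdS z) + ab1S x * (pdouS y * qB z) - ab1oS x * (qB y * pdS z) -
    qb1S x * (pdouS y * aS z)

/-- The term whose `o`-factor sits in the first copy (term 3). -/
def KIoX (x y z : St) : ℤ := - (ab1oS x * (qB y * pdS z))
/-- The terms whose `o`-factor sits in the second copy (terms 1, 2, 4). -/
def KIoY (x y z : St) : ℤ :=
  qb1S x * (aoS y * pdS z) + ab1S x * (pdouS y * qB z) - qb1S x * (pdouS y * aS z)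

/-- `KIst = KIoX + KIoY`. -/
lemma KIst_eq_oX_add_oY (x y z : St) : KIst x y z = KIoX x y z + KIoY x y z := by
  unfold KIst KIoX KIoY; ring

/-- **`KIst` vanishes when a copy fails `Q`.** -/
theorem KIst_eq_zero_of_q' (x y z : St) (h : x.q' = true ∨ y.q' = true ∨ z.q' = true) :
    KIst x y z = 0 := by
  rcases h with h | h | h <;> simp [KIst, qb1S, ab1S, ab1oS, aS, aoS, pdS, pdouS, qB, h]

/-- **The pendant-`b` identity on states**: every `b`-factor sits in the first copy. -/
theorem KIst_killB (p q r : Bool) (x y z : St) :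
    KIst (cond p x (killB x)) (cond q y (killB y)) (cond r z (killB z)) =
      (if p then KIst x y z else 0) + (if q then (0 : ℤ) else 0) + (if r then (0 : ℤ) else 0) := by
  cases p <;> cases q <;> cases r <;>
    simp [KIst, qb1S, ab1S, ab1oS, aS, aoS, pdS, pdouS, qB, killB_q', killB_Lo, killB_Ho,
      killB_Lb, killB_L3, killB_H3]

/-- **The pendant-`o` identity on states**: the `o`-factor sits in the first copy (term 3) or the
second (terms 1, 2, 4). -/
theorem KIst_killO (p q r : Bool) (x y z : St) :
    KIst (cond p x (killO x)) (cond q y (killO y)) (cond r z (killO z)) =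
      (if p then KIoX x y z else 0) + (if q then KIoY x y z else 0) + (if r then (0 : ℤ) else 0) := by
  cases p <;> cases q <;> cases r <;>
    simp [KIst, KIoX, KIoY, qb1S, ab1S, ab1oS, aS, aoS, pdS, pdouS, qB, killO_q', killO_Lo,
      killO_Ho, killO_L3, killO_H3] <;> ring

end StateKernelI

/-! ## `KI` through the state -/

section BridgeI

open Classical

variable {V : Type*} {E : Type*} {R : Type*} [Field R]
variable (ends : E → Sym2 V) (o a₁ a₂ a₃ b : V)

/-- `1_QB₁` through the state. -/
lemma iQB₁_eq_st (ω : Config E) :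
    CaseOne.iQB₁ (R := R) ends a₁ a₂ b ω = ((qb1S (st ends o a₁ a₂ a₃ b ω) : ℤ) : R) := by
  unfold CaseOne.iQB₁ qb1S st St.q' St.Lb
  have e1 : Conn ends ω a₁ a₂ ↔ Conn ends ω a₂ a₁ := ⟨conn_symm, conn_symm⟩
  simp only [Set.indicator_apply, Set.mem_inter_iff, Set.mem_compl_iff, mem_connEvent,
    Pi.one_apply, e1]
  by_cases h1 : Conn ends ω a₂ a₁ <;> by_cases h2 : Conn ends ω a₁ b <;> simp [h1, h2]

/-- `1_AB₁` through the state. -/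
lemma iAB₁_eq_st (ω : Config E) :
    CaseOne.iAB₁ (R := R) ends a₁ a₂ a₃ b ω = ((ab1S (st ends o a₁ a₂ a₃ b ω) : ℤ) : R) := by
  unfold CaseOne.iAB₁ ab1S st St.q' St.Lb St.L3
  have e1 : Conn ends ω a₁ a₂ ↔ Conn ends ω a₂ a₁ := ⟨conn_symm, conn_symm⟩
  simp only [Set.indicator_apply, Set.mem_inter_iff, Set.mem_compl_iff, mem_connEvent,
    Pi.one_apply, e1]
  by_cases h1 : Conn ends ω a₂ a₁ <;> by_cases h2 : Conn ends ω a₁ b <;>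
    by_cases h3 : Conn ends ω a₁ a₃ <;> simp [h1, h2, h3]

/-- `1_AB₁O` through the state. -/
lemma iAB₁O_eq_st (ω : Config E) :
    CaseOne.iAB₁O (R := R) ends o a₁ a₂ a₃ b ω = ((ab1oS (st ends o a₁ a₂ a₃ b ω) : ℤ) : R) := by
  unfold CaseOne.iAB₁O ab1oS st St.q' St.Lb St.L3 St.Ho
  have e1 : Conn ends ω a₁ a₂ ↔ Conn ends ω a₂ a₁ := ⟨conn_symm, conn_symm⟩
  simp only [Set.indicator_apply, Set.mem_inter_iff, Set.mem_compl_iff, mem_connEvent,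
    Pi.one_apply, e1]
  by_cases h1 : Conn ends ω a₂ a₁ <;> by_cases h2 : Conn ends ω a₁ b <;>
    by_cases h3 : Conn ends ω a₁ a₃ <;> by_cases h4 : Conn ends ω a₂ o <;> simp [h1, h2, h3, h4]

/-- **`KI` on states.** -/
theorem KI_eq_KIst (x y z : Config E) :
    KI (R := R) ends o a₁ a₂ a₃ b x y z =
      ((KIst (st ends o a₁ a₂ a₃ b x) (st ends o a₁ a₂ a₃ b y) (st ends o a₁ a₂ a₃ b z) : ℤ) : R) := by
  unfold KI sepKernel
  simp only [Fin.sum_univ_succ, Fin.sum_univ_zero, Matrix.cons_val_zero, Matrix.cons_val_succ,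
    add_zero]
  simp only [iQB₁_eq_st ends o a₁ a₂ a₃ b, iAB₁_eq_st ends o a₁ a₂ a₃ b, iAB₁O_eq_st ends o a₁ a₂ a₃ b,
    iAO_eq_st ends o a₁ a₂ a₃ b, iPDoU_eq_st ends o a₁ a₂ a₃ b, iQ_eq_st' ends o a₁ a₂ a₃ b,
    iPDc_eq_st ends o a₁ a₂ a₃ b, iA_eq_st ends o a₁ a₂ a₃ b]
  unfold KIst
  push_cast
  ring

/-- **`KI` is the state kernel of `KIst`.** -/
theorem KI_eq_stKer :
    (KI ends o a₁ a₂ a₃ b : Config E → Config E → Config E → R) =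
      stKer ends o a₁ a₂ a₃ b (fun x y z => ((KIst x y z : ℤ) : R)) := by
  funext x y z
  exact KI_eq_KIst ends o a₁ a₂ a₃ b x y z

end BridgeI

/-! ## The calculus applies to `KI` -/

section RuleI

variable {R : Type*} [Field R]

/-- **`KIst` satisfies the inputs of the reduction calculus.** -/
theorem ruleKernel_KIst : RuleKernel (fun x y z : St => ((KIst x y z : ℤ) : R)) where
  root_pair := fun x y z h => by rw [KIst_eq_zero_of_q' x y z h]; simp
  pendant_b := ⟨fun x y z => ((KIst x y z : ℤ) : R), fun _ _ _ => 0, fun _ _ _ => 0,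
    fun x y z => by ring,
    fun p q r x y z => by
      rw [KIst_killB]
      cases p <;> cases q <;> cases r <;> simp⟩
  pendant_o := ⟨fun x y z => ((KIoX x y z : ℤ) : R), fun x y z => ((KIoY x y z : ℤ) : R),
    fun _ _ _ => 0,
    fun x y z => by rw [KIst_eq_oX_add_oY]; push_cast; ring,
    fun p q r x y z => by
      rw [KIst_killO]
      cases p <;> cases q <;> cases r <;> simp⟩

end RuleI

/-! ## The transport -/

section TransportI

variable {V : Type*} {E : Type*} [DecidableEq V] [Fintype E] [DecidableEq E] {R : Type*} [Field R]
  [LinearOrder R] [IsStrictOrderedRing R]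

/-- **The typed counts of `KI` on every instance from the fully reduced typed graphs.** -/
theorem typedCount_KI_nonneg_of_reduced
    (hNR : ∀ (ends : E → Sym2 V) (o a₁ a₂ a₃ b : V) (F : Finset E) (τ : E → ℕ),
      (∀ e ∈ F, τ e = 1 ∨ τ e = 2) → Reduced ends o a₁ a₂ a₃ b F →
        0 ≤ typedCount F (fun _ => false) τ
          (KI ends o a₁ a₂ a₃ b : Config E → Config E → Config E → R))
    (ends : E → Sym2 V) (o a₁ a₂ a₃ b : V) (F : Finset E) (z : Config E) (τ : E → ℕ)
    (hτ : ∀ e ∈ F, τ e = 1 ∨ τ e = 2) :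
    0 ≤ typedCount F z τ (KI ends o a₁ a₂ a₃ b : Config E → Config E → Config E → R) := by
  rw [KI_eq_stKer]
  refine typedCount_nonneg_of_reduced_st _ ruleKernel_KIst
    (fun ends o a₁ a₂ a₃ b F τ hτ hred => ?_) ends o a₁ a₂ a₃ b F z τ hτ
  rw [← KI_eq_stKer]
  exact hNR ends o a₁ a₂ a₃ b F τ hτ hred

/-- **The transport for `(i)`**: `(i)` on the fully reduced typed graphs gives `TypedI`. -/
theorem typedI_of_reduced
    (hNR : ∀ (ends : E → Sym2 V) (o a₁ a₂ a₃ b : V) (F : Finset E) (τ : E → ℕ),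
      (∀ e ∈ F, τ e = 1 ∨ τ e = 2) → Reduced ends o a₁ a₂ a₃ b F →
        0 ≤ typedCount F (fun _ => false) τ
          (KI ends o a₁ a₂ a₃ b : Config E → Config E → Config E → R))
    (ends : E → Sym2 V) (o a₁ a₂ a₃ b : V) : TypedI (R := R) ends o a₁ a₂ a₃ b := by
  intro q G σ hq _ hσ
  exact triSum_nonneg_of_typedCount (KI ends o a₁ a₂ a₃ b)
    (fun F z τ hτ => typedCount_KI_nonneg_of_reduced hNR ends o a₁ a₂ a₃ b F z τ hτ) q hq G σ hσ

/-- **`(i)` for every admissible weight vector from `(i)` on the fully reduced typed graphs.** -/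
theorem zSplitI_of_reduced
    (hNR : ∀ (ends : E → Sym2 V) (o a₁ a₂ a₃ b : V) (F : Finset E) (τ : E → ℕ),
      (∀ e ∈ F, τ e = 1 ∨ τ e = 2) → Reduced ends o a₁ a₂ a₃ b F →
        0 ≤ typedCount F (fun _ => false) τ
          (KI ends o a₁ a₂ a₃ b : Config E → Config E → Config E → R))
    (ends : E → Sym2 V) (o a₁ a₂ a₃ b : V) (p : E → R) (hp : IsProbVec p) :
    ZSplitI p ends o a₁ a₂ a₃ b :=
  zSplitI_of_pinned ends o a₁ a₂ a₃ b (typedI_of_reduced hNR ends o a₁ a₂ a₃ b) p hp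

/-- **`(J1₁)` for every admissible weight vector from `(i)` and `(ii)` on the fully reduced typed
graphs** (the case-1 rung of the (J1) line in the (TRI) architecture, in the kernel). -/
theorem jOneOne_of_reduced
    (hI : ∀ (ends : E → Sym2 V) (o a₁ a₂ a₃ b : V) (F : Finset E) (τ : E → ℕ),
      (∀ e ∈ F, τ e = 1 ∨ τ e = 2) → Reduced ends o a₁ a₂ a₃ b F →
        0 ≤ typedCount F (fun _ => false) τ
          (KI ends o a₁ a₂ a₃ b : Config E → Config E → Config E → R))
    (hII : ∀ (ends : E → Sym2 V) (o a₁ a₂ a₃ b : V) (F : Finset E) (τ : E → ℕ),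
      (∀ e ∈ F, τ e = 1 ∨ τ e = 2) → Reduced ends o a₁ a₂ a₃ b F →
        0 ≤ typedCount F (fun _ => false) τ
          (KII ends o a₁ a₂ a₃ b : Config E → Config E → Config E → R))
    (ends : E → Sym2 V) (o a₁ a₂ a₃ b : V) (p : E → R) (hp : IsProbVec p) :
    JOneOne p ends o a₁ a₂ a₃ b :=
  jOneOne_of_pinned ends o a₁ a₂ a₃ b (typedI_of_reduced hI ends o a₁ a₂ a₃ b)
    (typedII_of_reduced hII ends o a₁ a₂ a₃ b) p hp

end TransportI

end CaseOne

end Summit.Ventures.PercRepro2
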